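import Mathlib.Topology.Algebra.Order.Archimedean
import Mathlib.Analysis.SpecialFunctions.Trigonometric.Basic
import Literature.Probability.LatticeModels.ScalingLimit
import HarnessLib

/-!
# Route GaussianScaleMixture — crux `RotationUpgradeFromTwoPoint` (stmt-CriticalPhenomena-8367),
# line `two-crystals-generate-so3`, stub `stub_circleClosed`

THEOREM-ONLY file (no definitions, no named facts). **A one-parameter group of isometries meeting
a closed invariance group in an irrational angle lies in it.** Let `S : CorrFamily 3` be continuous
on `NonCoincident` and zero off it, and let `T : ℝ → O(3)` be a one-parameter family of linear
isometries with `T (φ + ψ) = T φ ∘ T ψ`, `φ ↦ T φ x` continuous and `T (2π) = 1`. If `θ₀` is not a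
rational multiple of `2π` and `S` is `T θ₀`-invariant, then `S` is `T φ`-invariant for every `φ`.

Proof. `H := {φ | ∀ n x, S n (T φ ∘ x) = S n x}` is an additive subgroup of `ℝ` (`T 0 = 1` by the
group law and injectivity of `T 0`; inverses via `T φ ∘ T (−φ) = T 0 = 1`). It is CLOSED: for an
injective configuration `x`, `φ ↦ S n (T φ ∘ x)` is continuous (isometries are injective, so
`T φ ∘ x` stays in `NonCoincident`, where `S n` is continuous), and for a non-injective `x` both
sides vanish identically. Also `θ₀ ∈ H` and `2π ∈ H`. By `AddSubgroup.dense_or_cyclic`, either `H`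
is dense — then, being closed, `H = ℝ` — or `H = ℤ a`; in the latter case `θ₀ = k a` and
`2π = m a` with `m ≠ 0` (as `2π ≠ 0`), so `m θ₀ = k · 2π`, contradicting irrationality.
-/

noncomputable section

open Literature.Probability.LatticeModels

namespace Summit.CriticalPhenomena.Ising3DConformalLimit.Cruxes.RotationUpgradeFromTwoPoint.TwoCrystalsGenerateSo3

/-- A closed additive subgroup of `ℝ` containing `2π` and some `θ₀` which is not a rational
multiple of `2π` is all of `ℝ` (dichotomy `AddSubgroup.dense_or_cyclic`: a dense closed subgroup
is everything; a cyclic one `ℤ a ∋ θ₀, 2π` would make `θ₀ / 2π` rational). [folklore] -/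
theorem circ_addSubgroup_mem_of_isClosed_of_irrational (H : AddSubgroup ℝ) (θ₀ : ℝ)
    (hclosed : IsClosed (H : Set ℝ))
    (hirr : ∀ m k : ℤ, m ≠ 0 → (m : ℝ) * θ₀ ≠ (k : ℝ) * (2 * Real.pi))
    (hθ₀ : θ₀ ∈ H) (h2pi : 2 * Real.pi ∈ H) (φ : ℝ) : φ ∈ H := by
  rcases AddSubgroup.dense_or_cyclic H with hdense | ⟨a, ha⟩
  · have huniv : (H : Set ℝ) = Set.univ := by
      rw [← hclosed.closure_eq, hdense.closure_eq]
    have hφ : φ ∈ (H : Set ℝ) := by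
      rw [huniv]
      exact Set.mem_univ φ
    exact hφ
  · rw [ha, AddSubgroup.mem_closure_singleton] at hθ₀ h2pi
    obtain ⟨k, hk⟩ := hθ₀
    obtain ⟨m, hm⟩ := h2pi
    have hm0 : m ≠ 0 := by
      rintro rfl
      rw [zero_zsmul] at hm
      have hpos : (0 : ℝ) < 2 * Real.pi := by positivity
      exact hpos.ne hm
    exact absurd (show (m : ℝ) * θ₀ = (k : ℝ) * (2 * Real.pi) by
      rw [← hk, ← hm, zsmul_eq_mul, zsmul_eq_mul]; ring) (hirr m k hm0)

/-- For a one-parameter family `T` of linear isometries with the group law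
`T (φ + ψ) = T φ ∘ T ψ`, the time-zero map is the identity: `T 0 x = x` (apply the group law at
`φ = ψ = 0` and cancel the injective map `T 0`). [folklore] -/
theorem circ_oneParam_zero_apply
    (T : ℝ → (EuclideanSpace ℝ (Fin 3) ≃ₗᵢ[ℝ] EuclideanSpace ℝ (Fin 3)))
    (hgrp : ∀ φ ψ x, T (φ + ψ) x = T φ (T ψ x)) (x : EuclideanSpace ℝ (Fin 3)) : T 0 x = x := by
  have h := hgrp 0 0 x
  rw [add_zero] at h
  exact ((T 0).injective h).symm

/-- For a one-parameter family `T` of linear isometries with the group law, `T φ` undoes `T (-φ)`: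
`T φ (T (-φ) x) = x`. [folklore] -/
theorem circ_oneParam_apply_neg_apply
    (T : ℝ → (EuclideanSpace ℝ (Fin 3) ≃ₗᵢ[ℝ] EuclideanSpace ℝ (Fin 3)))
    (hgrp : ∀ φ ψ x, T (φ + ψ) x = T φ (T ψ x)) (φ : ℝ) (x : EuclideanSpace ℝ (Fin 3)) :
    T φ (T (-φ) x) = x := by
  rw [← hgrp, add_neg_cancel, circ_oneParam_zero_apply T hgrp]

/-- Closedness of one invariance condition. If `S n` is continuous on `NonCoincident` and vanishes
off it, and `φ ↦ T φ y` is continuous for every point `y`, then for every configuration `x` the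
set `{φ | S n (T φ ∘ x) = S n x}` is closed: for injective `x` the map `φ ↦ S n (T φ ∘ x)` is
continuous (isometries preserve injectivity), and for non-injective `x` the set is all of `ℝ`
(both sides vanish). [folklore] -/
theorem circ_isClosed_invSet (S : CorrFamily 3)
    (T : ℝ → (EuclideanSpace ℝ (Fin 3) ≃ₗᵢ[ℝ] EuclideanSpace ℝ (Fin 3)))
    (hcont : ∀ n, ContinuousOn (S n) (NonCoincident 3 n))
    (hzero : ∀ n z, z ∉ NonCoincident 3 n → S n z = 0)
    (hTcont : ∀ x, Continuous fun φ => T φ x)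
    (n : ℕ) (x : Fin n → EuclideanSpace ℝ (Fin 3)) :
    IsClosed {φ : ℝ | S n (fun i => T φ (x i)) = S n x} := by
  by_cases hx : Function.Injective x
  · have hcts : Continuous fun φ : ℝ => S n (fun i => T φ (x i)) := by
      refine (hcont n).comp_continuous (continuous_pi fun i => hTcont (x i)) fun φ => ?_
      rw [mem_nonCoincident]
      exact (T φ).injective.comp hx
    exact isClosed_eq hcts continuous_const
  · have huniv : {φ : ℝ | S n (fun i => T φ (x i)) = S n x} = Set.univ := by
      refine Set.eq_univ_of_forall fun φ => ?_
      have hx' : ¬ Function.Injective (fun i => T φ (x i)) := fun h =>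
        hx (((T φ).injective.of_comp_iff x).mp h)
      rw [Set.mem_setOf_eq, hzero n x (by rwa [mem_nonCoincident]),
        hzero n _ (by rwa [mem_nonCoincident])]
    rw [huniv]
    exact isClosed_univ

/-- **Stub `stub_circleClosed`.** A one-parameter group of linear isometries of `ℝ³`
(`T (φ + ψ) = T φ ∘ T ψ`, `φ ↦ T φ x` continuous, `T (2π) = 1`) meeting the invariance group of a
family `S` (continuous on `NonCoincident`, zero off it) in an angle `θ₀` that is not a rational
multiple of `2π` lies entirely in that invariance group. Proof: the set `H` of invariance angles
is a closed additive subgroup of `ℝ` containing `θ₀` and `2π`, hence all of `ℝ` by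
`circ_addSubgroup_mem_of_isClosed_of_irrational`. [folklore] -/
theorem stub_circleClosed :
  ∀ (S : CorrFamily 3) (T : ℝ → (EuclideanSpace ℝ (Fin 3) ≃ₗᵢ[ℝ] EuclideanSpace ℝ (Fin 3))) (θ₀ : ℝ),
    (∀ n, ContinuousOn (S n) (NonCoincident 3 n)) →
    (∀ n z, z ∉ NonCoincident 3 n → S n z = 0) →
    (∀ φ ψ x, T (φ + ψ) x = T φ (T ψ x)) →
    (∀ x, Continuous fun φ => T φ x) →
    (∀ x, T (2 * Real.pi) x = x) →
    (∀ m k : ℤ, m ≠ 0 → (m : ℝ) * θ₀ ≠ (k : ℝ) * (2 * Real.pi)) →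
    (∀ (n : ℕ) (x : Fin n → EuclideanSpace ℝ (Fin 3)), S n (fun i => T θ₀ (x i)) = S n x) →
    ∀ (φ : ℝ) (n : ℕ) (x : Fin n → EuclideanSpace ℝ (Fin 3)), S n (fun i => T φ (x i)) = S n x := by
  intro S T θ₀ hcont hzero hgrp hTcont h2pi hirr hθ₀ φ
  -- the invariance angles form an additive subgroup of `ℝ`
  let H : AddSubgroup ℝ :=
    { carrier := {ψ : ℝ | ∀ (n : ℕ) (x : Fin n → EuclideanSpace ℝ (Fin 3)),
        S n (fun i => T ψ (x i)) = S n x}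
      add_mem' := by
        intro a b ha hb n x
        have hab : (fun i => T (a + b) (x i)) = fun i => T a (T b (x i)) := funext fun i => hgrp a b (x i)
        rw [hab, ha n (fun i => T b (x i)), hb n x]
      zero_mem' := by
        intro n x
        have h0 : (fun i => T 0 (x i)) = x := funext fun i => circ_oneParam_zero_apply T hgrp (x i)
        rw [h0]
      neg_mem' := by
        intro a ha n x
        have h := ha n (fun i => T (-a) (x i))
        have hna : (fun i => T a (T (-a) (x i))) = x :=
          funext fun i => circ_oneParam_apply_neg_apply T hgrp a (x i)
        simp only [hna] at h
        exact h.symm }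
  -- it is closed
  have hclosed : IsClosed (H : Set ℝ) := by
    have hcoe : (H : Set ℝ) = ⋂ (n : ℕ), ⋂ (x : Fin n → EuclideanSpace ℝ (Fin 3)),
        {ψ : ℝ | S n (fun i => T ψ (x i)) = S n x} := by
      ext ψ
      simp only [Set.mem_iInter, Set.mem_setOf_eq]
      exact Iff.rfl
    rw [hcoe]
    exact isClosed_iInter fun n => isClosed_iInter fun x =>
      circ_isClosed_invSet S T hcont hzero hTcont n x
  -- it contains `θ₀` and `2π`
  have hθ₀H : θ₀ ∈ H := hθ₀
  have h2piH : 2 * Real.pi ∈ H := by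
    intro n x
    have h2 : (fun i => T (2 * Real.pi) (x i)) = x := funext fun i => h2pi (x i)
    rw [h2]
  -- hence it is everything
  have hφ : φ ∈ H := circ_addSubgroup_mem_of_isClosed_of_irrational H θ₀ hclosed hirr hθ₀H h2piH φ
  exact hφ

end Summit.CriticalPhenomena.Ising3DConformalLimit.Cruxes.RotationUpgradeFromTwoPoint.TwoCrystalsGenerateSo3

end
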